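/-
Origin: expansion seat `planner-pub-hodgecm-pv09-g3-0`, handover 2026-08-18T06:02:34Z (`HOME/pub-hodgecm-pv09-g3/lean/Pv09g3/HaarPieces.lean`, md5 687996e8, 159 lines);
landed by the gen-6 packager in gate run 24 as `HodgeCM/PerL34/HaarPieces.lean` (import ^import Pv[0-9]+g[0-9]+\.→import HodgeCM.PerL34. ×1).
-/
/-
Copyright: HodgeCM publication cell (pub-hodgecm), DAG node N31 — seam S3 / seam (I) (prover pv09, gen 3).
Released under the package licence.

# The canonical `LocalFactorPieces` over the HAAR datum: the measure datum is CONSTRUCTED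

Source under adjudication (NOT cited as a fact; this file PROVES a typed piece of it):
PerL v5 = `inputs/2001/summits__hodge-w-picard-modular-quadrilinear-period-galois-
closure__free__y1__paper__paper.tex`, Lemma 4.2(b), proof, tex l. 611–631 (the measure `dy` on
`U(W_i)(𝔸_F)` is the restricted product of the local Haar measures normalised by `vol(U(W_i)(𝒪_v)) = 1`
for almost all `v`).

## What this file does

Items 7–9 take the restricted product measure datum `D` (pv11's `RestrictedProductMeasureDatum`)
as a HYPOTHESIS together with `IsCoordinate D` and `[∀ i, (D.ν i).IsInvInvariant]`.  For compact OPEN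
subgroups `B_i` of Hausdorff, second-countable, locally compact ABELIAN groups `G_i` this file
CONSTRUCTS the datum and discharges all three:
* `posCompacts B hBc hBo i : PositiveCompacts (G i)` — `B_i` as a positive compact (interior = itself,
  contains `1`);
* `haarDatum B hBc hBo S₀ := RestrictedProductMeasureDatum.ofHaar (posCompacts …) S₀` (pv09-g2, LANDED
  run 22: Mathlib's `haarMeasure (B_i)` normalised by `haarMeasure (B_i) (B_i) = 1`, glued by Leahy
  Prop. 3.1.8) — a datum over `Πʳ_i [G_i, B_i]` ON THE NOSE;
* `isCoordinate_haarDatum` (item 1's `isCoordinate_ofHaar`) and `isInvInvariant_haarDatum_ν` (Mathlib: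
  a regular Haar measure on an abelian locally compact group is inversion invariant);
* **`haarPieces : LocalFactorPieces ι E`**, `haarPieces_I`, **`rallis_haar`**, **`theta_ne_zero_haar`** —
  item 9's final form with `D`, `hD` and the invariance instance GONE.
RESIDUAL (hypotheses of `theta_ne_zero_haar`): the groups/subgroups (`G_i` abelian l.c. Hausdorff
2nd-countable, `B_i` compact open), the finite Haar-exceptional set `S₀`; `‖φ‖ = 1`, `Continuous (y ↦ ω y φ)`,
`hK`, `hM` (D4/D5: the posited restricted tensor product); `Continuous χ′`, level `T′`; `0 < c`,
`0 < vol 𝓕 < ∞`, `θ ∈ Θ`, `hN31e`, `hnorm`; `UnramifiedPlaceData` outside `S`; integrability + `0 < I_i` on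
`S`; `summable_t`.  Nothing is cited; no hypothesis names PerL, QW8 or a 2001-programme claim.
Imports: item 9.  Axioms = the standard trio.
Unit `pub-hodgecm-pv09-g3` (DAG-node prover #09, generation 3), 2026-08-18.
-/
import Summits.HodgeConjecture.HodgeCM.PerL34.Measurability

/-! PORT of `HodgeCM/PerL34/HaarPieces.lean` (HodgeCMPerL run 82) — verbatim mechanical port; provenance in the PORT header line. -/

set_option autoImplicit false

noncomputable section

open MeasureTheory Set Filter Function Topology Complex ComplexConjugate

open scoped RestrictedProduct InnerProductSpace

namespace HodgeCM.PerL34.PureTensor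

open HodgeCM.PerL34.AdelicFactorisation HodgeCM.PerL34.RestrictedMeasure
  HodgeCM.PerL34.NoSmallSubgroups HodgeCM.PerL34.EulerFactorisation

section haarDatum

variable {ι : Type} {G : ι → Type} [∀ i, CommGroup (G i)] [∀ i, TopologicalSpace (G i)]
  [∀ i, IsTopologicalGroup (G i)] [∀ i, T2Space (G i)] [∀ i, SecondCountableTopology (G i)]
  [∀ i, MeasurableSpace (G i)] [∀ i, BorelSpace (G i)] [Countable ι]
  (B : ∀ i, Subgroup (G i)) (hBc : ∀ i, IsCompact (B i : Set (G i)))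
  (hBo : ∀ i, IsOpen (B i : Set (G i)))

omit [∀ i, IsTopologicalGroup (G i)] [∀ i, T2Space (G i)] [∀ i, SecondCountableTopology (G i)]
  [∀ i, MeasurableSpace (G i)] [∀ i, BorelSpace (G i)] [Countable ι] in
/-- A compact open subgroup as a positive compact set (its interior is itself and contains `1`). -/
def posCompacts (i : ι) : TopologicalSpace.PositiveCompacts (G i) where
  carrier := B i
  isCompact' := hBc i
  interior_nonempty' := by
    rw [(hBo i).interior_eq]
    exact ⟨1, (B i).one_mem⟩

omit [∀ i, IsTopologicalGroup (G i)] [∀ i, T2Space (G i)] [∀ i, SecondCountableTopology (G i)]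
  [∀ i, MeasurableSpace (G i)] [∀ i, BorelSpace (G i)] [Countable ι] in
/-- (Ported verbatim from the HodgeCMPerL package; no docstring in the source.) -/
@[simp] theorem coe_posCompacts (i : ι) : (posCompacts B hBc hBo i : Set (G i)) = B i := rfl

/-- **The Haar datum over `Πʳ_i [G_i, B_i]`** (pv09-g2 `ofHaar` with the compact open subgroups as the
positive compacts; `S₀` = the finite set of places where the local Haar measure is not renormalised). -/
def haarDatum (S₀ : Finset ι) : RestrictedProductMeasureDatum ι G (Πʳ i, [G i, B i]) :=
  RestrictedProductMeasureDatum.ofHaar (posCompacts B hBc hBo) S₀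

/-- (Ported verbatim from the HodgeCMPerL package; no docstring in the source.) -/
@[simp] theorem haarDatum_ν (S₀ : Finset ι) (i : ι) :
    (haarDatum B hBc hBo S₀).ν i = Measure.haarMeasure (posCompacts B hBc hBo i) := rfl

/-- (Ported verbatim from the HodgeCMPerL package; no docstring in the source.) -/
theorem haarDatum_ν_self (S₀ : Finset ι) (i : ι) :
    (haarDatum B hBc hBo S₀).ν i (B i : Set (G i)) = 1 := by
  rw [haarDatum_ν, ← coe_posCompacts B hBc hBo i]
  exact Measure.haarMeasure_self

/-- The Haar datum has coordinate gluing maps (item 1). -/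
theorem isCoordinate_haarDatum (S₀ : Finset ι) : IsCoordinate (haarDatum B hBc hBo S₀) :=
  isCoordinate_ofHaar _ _

/-- The local Haar measures of the Haar datum are inversion invariant (abelian groups; Mathlib). -/
instance isInvInvariant_haarDatum_ν [∀ i, LocallyCompactSpace (G i)] (S₀ : Finset ι) (i : ι) :
    ((haarDatum B hBc hBo S₀).ν i).IsInvInvariant := by
  rw [haarDatum_ν]
  infer_instance

end haarDatum

section haar

variable {ι : Type} {G : ι → Type} [∀ i, CommGroup (G i)] [∀ i, TopologicalSpace (G i)]
  [∀ i, IsTopologicalGroup (G i)] [∀ i, T2Space (G i)] [∀ i, SecondCountableTopology (G i)]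
  [∀ i, LocallyCompactSpace (G i)] [∀ i, MeasurableSpace (G i)] [∀ i, BorelSpace (G i)]
  [Countable ι] [DecidableEq ι]
  (B : ∀ i, Subgroup (G i)) (hBc : ∀ i, IsCompact (B i : Set (G i)))
  (hBo : ∀ i, IsOpen (B i : Set (G i))) (S₀ : Finset ι)
  {Sp : Type} [NormedAddCommGroup Sp] [InnerProductSpace ℂ Sp]
  {E : Type*} [NormedAddCommGroup E] [InnerProductSpace ℂ E]
  (ω : (Πʳ j, [G j, B j]) →* (Sp ≃ₗᵢ[ℂ] Sp)) (φ : Sp) (hφ : ‖φ‖ = 1)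
  (hω : Continuous fun y => ω y φ)
  (χ : (Πʳ j, [G j, B j]) →* Circle) (hχ : Continuous χ)
  (𝓕 : Set (Πʳ j, [G j, B j])) (K : (Πʳ j, [G j, B j]) → (Πʳ j, [G j, B j]) → ℂ) (c : ℝ)
  (c_pos : 0 < c) (vol_ne_zero : (haarDatum B hBc hBo S₀).μ 𝓕 ≠ 0)
  (vol_ne_top : (haarDatum B hBc hBo S₀).μ 𝓕 ≠ ⊤) (θ : E) (Θ : Set E) (hθ : θ ∈ Θ)
  (hN31e : RallisIP.N31e_statement (haarDatum B hBc hBo S₀).μ 𝓕 ω φ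
    (fun y => ((χ y : Circle) : ℂ)) K (c : ℂ))
  (hnorm : ⟪θ, θ⟫_ℂ = ∫ u in 𝓕, ∫ u' in 𝓕, ((χ u : Circle) : ℂ) * conj ((χ u' : Circle) : ℂ) *
    K u u' ∂(haarDatum B hBc hBo S₀).μ ∂(haarDatum B hBc hBo S₀).μ)
  {T T' : Finset ι} (hK : ∀ k ∈ RestrictedProduct.boxSubgroup B T, ω k φ = φ)
  (hχT' : RestrictedProduct.boxSubgroup B T' ≤ χ.ker)
  (hM : ∀ S : Finset ι, T ⊆ S → ∀ y : (i : ↥S) → G i,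
    inner ℂ φ (ω (extendOne B S y) φ) = ∏ i : ↥S, localCoeff B ω φ i (y i))
  {S : Finset ι} {q : ι → ℕ} {chiPi nuPi : ι → ℂ} {IsSplit : ι → Prop}
  (X : UnramifiedPlaceData B (haarDatum B hBc hBo S₀) ω φ χ S q chiPi nuPi IsSplit)
  (hTS : T ⊆ S) (hT'S : T' ⊆ S)
  (hclS : ∀ i ∈ S, Integrable (localCoeff B ω φ i) ((haarDatum B hBc hBo S₀).ν i))
  (ram_pos : ∀ i ∈ S, 0 < (localIntegrand B (haarDatum B hBc hBo S₀) ω φ χ i).I)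
  (hsum : Summable fun i : {j : ι // j ∉ S} => EulerProduct.tOf (q i.1))

include hφ hω hχ c_pos vol_ne_zero vol_ne_top hθ hN31e hnorm hK hχT' hM X hTS hT'S hclS ram_pos hsum

/-- **The canonical `LocalFactorPieces` over the Haar datum**: measure datum, coordinate property and
inversion invariance are CONSTRUCTED / PROVED, not assumed. -/
def haarPieces : LocalFactorPieces ι E :=
  canonicalPiecesFinal B hBo (haarDatum B hBc hBo S₀) (isCoordinate_haarDatum B hBc hBo S₀) ω φ hφ
    hω χ hχ 𝓕 K c c_pos vol_ne_zero vol_ne_top θ Θ hθ hN31e hnorm hK hχT' hM X hTS hT'S hclS ram_pos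
    hsum

/-- (Ported verbatim from the HodgeCMPerL package; no docstring in the source.) -/
theorem haarPieces_I (i : ι) :
    (haarPieces B hBc hBo S₀ ω φ hφ hω χ hχ 𝓕 K c c_pos vol_ne_zero vol_ne_top θ Θ hθ hN31e hnorm hK
      hχT' hM X hTS hT'S hclS ram_pos hsum).I i =
      (localIntegrand B (haarDatum B hBc hBo S₀) ω φ χ i).I := rfl

/-- **Rallis over the Haar datum**: `re ⟪θ, θ⟫ = c · vol([U(W_i)]) · ∏' I_i`. -/
theorem rallis_haar :
    RCLike.re ⟪θ, θ⟫_ℂ = c * ((haarDatum B hBc hBo S₀).μ 𝓕).toReal *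
      ∏' i, (localIntegrand B (haarDatum B hBc hBo S₀) ω φ χ i).I :=
  (haarPieces B hBc hBo S₀ ω φ hφ hω χ hχ 𝓕 K c c_pos vol_ne_zero vol_ne_top θ Θ hθ hN31e hnorm hK
    hχT' hM X hTS hT'S hclS ram_pos hsum).rallis

/-- **N31h over the Haar datum**: `θ ≠ 0`. -/
theorem theta_ne_zero_haar : θ ≠ 0 :=
  (haarPieces B hBc hBo S₀ ω φ hφ hω χ hχ 𝓕 K c c_pos vol_ne_zero vol_ne_top θ Θ hθ hN31e hnorm hK
    hχT' hM X hTS hT'S hclS ram_pos hsum).toLocalFactorDatum.theta_ne_zero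

end haar

end HodgeCM.PerL34.PureTensor

end
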